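import Mathlib
import HarnessLib
import Summits.MatrixMultiplication.Statement
import Summits.MatrixMultiplication.MatrixMultiplication.Theses.FarEdgeDescent
import Summits.MatrixMultiplication.MatrixMultiplication.Theorems.FarEdgeDescentHostDichotomy
import Literature.Barriers.MatrixMultiplication.IrreversibilityBarrierProofs
import Literature.Computability.AlgebraicComplexity.MatMulMonomialSubrank
import Literature.Computability.AlgebraicComplexity.SchoenhageTau
import Literature.Computability.AlgebraicComplexity.PencilRankVersusBorderRank

/-!
# FarEdgeDescent — Kernel XLIX-C (lens-2 «structural dichotomy», gen 65): UNIT DOMINATION —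
# the border-flat branch of the host dichotomy is the special crux itself

Support module (def-free, sorry-free) for the special crux `FiniteSaturation`
(stmt-MatrixMultiplication-23739) of `Summits/MatrixMultiplication/MatrixMultiplication/Theses/FarEdgeDescent.lean`;
the cut of record `closes (h₁ : FiniteSaturation) (h₂ : AnchoredLogConvexity)` is UNCHANGED.
Continues Kernel XLIX-A/B (`FarEdgeDescentHostProfile`, `FarEdgeDescentHostDichotomy`, gen 64).

Kernel XLIX typed a HOST of the far shape `(1,k,1)`: a fixed tensor `t` with a proxy `r ≥ R̃(t)`
whose Kronecker powers degenerate to `⟨m, m^k, m⟩` at cost `r^{N+1} ≤ m^{(k+1)(1+ε)}` for every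
`ε > 0`, and split hosts exhaustively into BORDER-FLAT (`R̲(t) = R̃(t) = r`, the special branch:
one finite identity certifies the proxy, `finiteSaturation_of_borderHost`) and STRICTLY FLAT
(`R̃(t) = r < R̲(t)`, the generic branch).  It recorded the generic branch as EQUIV at the level of
existence (`finiteSaturation_iff_selfHost`: under `e(k) = 0` the far tensor `⟨2,2^k,2⟩` is its own
`R̃`-host) and left the special branch's CANDIDATE POOL as the open question of the node
(critic g23, ask (a)).  This file closes that question by a theorem instead of a list:

* §1 ★★ `unitHost_of_saturated`: if `ω(1,k,1) = k + 1` then the UNIT TENSOR `⟨2⟩` — border rank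
  `2 = R̃ = |κ| = |μ|`, the flattest tensor there is — is a border-flat host of the shape `(1,k,1)`:
  for every `ε > 0` some power `⟨2⟩^{⊠(N+1)}` degenerates (indeed restricts) to `⟨m, m^k, m⟩`,
  `m = 2^e`, with `2^{N+1} ≤ m^{(k+1)(1+ε)}`.  Mechanism: `R̃(⟨2,2^k,2⟩) = 2^{k+1}` (Kernel XLIX-A),
  so `R(⟨2,2^k,2⟩^{⊠e}) ≤ 2^{e(k+1)(1+ε/2)}` along a progression of exponents `e`
  (`exists_tensorRank_kroneckerPow_le_of_asymptoticRank_lt`), `⟨2,2^k,2⟩^{⊠e} ≥ ⟨2^e, 2^{ke}, 2^e⟩`,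
  and `⟨2⟩^{⊠n} ≥ s ⟺ R(s) ≤ 2^n` (BCS (14.19)).
* §2 ★ `unitHost_of_host`: every host of `(1,k,1)` — any tensor, any admissible proxy, either branch —
  renormalises to the unit host `⟨2⟩` of the SAME shape (through the exponent; no composition of
  degenerations is needed); ★★ `finiteSaturation_iff_unitHost` and ★★★ `finiteSaturation_iff_exists_borderHost`:
  **`FiniteSaturation ⟺ ∃ k ≥ 2, ⟨2⟩ is a border-flat host of (1,k,1) ⟺ ∃ k ≥ 2 ∃ a border-flat
  host of (1,k,1) of any finite format`**.  So the SPECIAL branch of the host dichotomy, read as an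
  existence statement, is EQUIV to the crux (tag EQUIV/COSTUME as a piece), exactly like the
  generic branch; the dichotomy S ∨ G classifies CERTIFICATES of one and the same statement, not
  pieces of it.  The special pool is `{⟨r⟩ : r ≥ 2}` up to degeneration (every border-flat `t`
  has `t ⊴ ⟨R̲(t)⟩`), its universal member passes every format screen of XLIX-A trivially
  (`R̲ = R̃ = r = |κ| = |μ|`), and «is `⟨r⟩` a host of `(1,k,1)`» is verbatim «the border-rank
  exponent of `⟨m, m^k, m⟩` is `k + 1`», i.e. `e(k) = 0`.
* §4 ★★★★ `finiteSaturation_iff_exists_algBorderRank_le`: with the host gone, the crux in FINITE terms —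
  **`FiniteSaturation ⟺ ∃ k ≥ 2, ∀ ε > 0, ∃ m ≥ 2, R̲(⟨m, m^k, m⟩) ≤ m^{(k+1)(1+ε)}`**: one good
  format per tolerance suffices (a single format bounds the exponent, `m^{ω(1,k,1)} = R̃ ≤ R̲`), and
  saturation supplies them along `m = 2^e`.  The special branch is therefore exactly the design of
  approximate bilinear algorithms for single skinny formats; no intermediate tensor, power or limit
  appears in the statement.

Why this is novel (for the cell): gen 64 and the critic left the special branch as a pool to be
populated by explicit flat tensors (Schönhage pairs, `CW_q` failing the screen); unit domination
shows the pool question has no content beyond `h₁` — a kernel-checked COSTUME verdict that retires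
«∃ border-flat host» as a candidate piece for every later generation.  Nothing here proves `ω = 2`
or the crux; no definitions (gate rule D-0009).
[cite: BurgisserClausenShokrollahi1997, (14.19), (15.19), Lemma (15.27)]
[cite: ChristandlVranaZuiddam2023, §1.1] [cite: LottiRomani1983, Prop. 4.1]
[cite: AlmanLi2026, Cor. 6.1] [cite: AlmanDuanVassilevskaWilliamsXuXuZhou2025, §3.4]
Written by the decomp-mm lens-2 planner seat (gen 65); imports only BUILT modules.
-/

namespace Summit.MatrixMultiplication.MatrixMultiplication.Theorems.FarEdgeDescentHostUnit

open Literature.Computability.AlgebraicComplexity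
open Literature.Barriers.MatrixMultiplication
open Summit.MatrixMultiplication.MatrixMultiplication.Theses.FarEdgeDescent
open Summit.MatrixMultiplication.MatrixMultiplication.Theorems.FarEdgeDescentHostProfile
open Summit.MatrixMultiplication.MatrixMultiplication.Theorems.FarEdgeDescentHostBridge

/-! ## §1 The unit tensor `⟨2⟩` hosts every saturated far shape -/

/-- `R̲(⟨2⟩) ≤ 2` (`R̲ ≤ R ≤ 2`, the diagonal decomposition).
[cite: BurgisserClausenShokrollahi1997, (15.19)] -/
theorem algBorderRank_unitTensor_two_le : algBorderRank (unitTensor ℂ 2) ≤ 2 :=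
  (algBorderRank_le_tensorRank _).trans (tensorRank_unitTensor_le (K := ℂ) 2)

/-- **Powers of the far tensor restrict to far tensors**:
`⟨2, 2^k, 2⟩^{⊠e} ≥ ⟨2^e, (2^e)^k, 2^e⟩` (un-flattening, `(2^k)^e = (2^e)^k`). [folklore] -/
theorem kroneckerPow_farTensor_restrictsTo (k e : ℕ) :
    TensorRestrictsTo (kroneckerPow (matMulTensor ℂ 2 (2 ^ k) 2) e)
      (matMulTensor ℂ (2 ^ e) ((2 ^ e) ^ k) (2 ^ e)) := by
  rw [← pow_right_comm 2 k e]
  exact (tensorMonRestrictsTo_kroneckerPow_matMulTensor ℂ 2 (2 ^ k) 2 e).tensorRestrictsTo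

/-- ★★ **UNIT DOMINATION**: if the far shape `(1,k,1)` is saturated, `ω(1,k,1) = k + 1`, then the
unit tensor `⟨2⟩` is a border-flat host of it in the sense of Kernel XLIX (budget `b = 2 = R̲(⟨2⟩)`):
for every `ε > 0` there are `N, m` (`m = 2^e ≥ 2`) with `⟨2⟩^{⊠(N+1)} ⊵ ⟨m, m^k, m⟩` and
`2^{N+1} ≤ m^{(k+1)(1+ε)}`.  (`R̃(⟨2,2^k,2⟩) = 2^{k+1} < 2^{(k+1)(1+ε/2)}`, so
`R(⟨2,2^k,2⟩^{⊠e}) ≤ 2^{e(k+1)(1+ε/2)}` along `e = M i`; take `e` with `e ε > 4`,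
`N = ⌈e(k+1)(1+ε/2)⌉`, and `⟨2⟩^{⊠(N+1)} ≥ s ⟺ R(s) ≤ 2^{N+1}`.)
[cite: BurgisserClausenShokrollahi1997, (14.19)] [cite: ChristandlVranaZuiddam2023, §1.1]
[cite: AlmanDuanVassilevskaWilliamsXuXuZhou2025, §3.4] -/
theorem unitHost_of_saturated {k : ℕ} (hsat : omegaRect ℂ 1 k 1 = (k : ℝ) + 1) :
    ∀ ε : ℝ, 0 < ε → ∃ N m : ℕ, 2 ≤ m ∧
      AlgDegeneratesTo (kroneckerPow (unitTensor ℂ 2) (N + 1)) (matMulTensor ℂ m (m ^ k) m) ∧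
      (2 : ℝ) ^ (N + 1) ≤ (m : ℝ) ^ (((k : ℝ) + 1) * (1 + ε)) := by
  intro ε hε
  set T := matMulTensor ℂ 2 (2 ^ k) 2 with hT
  -- the asymptotic rank of the far tensor under saturation
  have hR : asymptoticRank T = (2 : ℝ) ^ ((k : ℝ) + 1) := by
    have h := rpow_omegaRect_eq_asymptoticRank_farEdge (le_refl 2) k
    rw [hsat] at h
    exact_mod_cast h.symm
  -- a rate strictly above it
  set a : ℝ := ((k : ℝ) + 1) * (1 + ε / 2) with ha
  have hk0 : (0 : ℝ) ≤ (k : ℝ) := Nat.cast_nonneg k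
  have ha0 : 0 < a := by rw [ha]; positivity
  have hka : (k : ℝ) + 1 < a := by rw [ha]; nlinarith
  have hlt : asymptoticRank T < (2 : ℝ) ^ a := by
    rw [hR]; exact Real.rpow_lt_rpow_of_exponent_lt one_lt_two hka
  obtain ⟨M, hM1, hM⟩ := exists_tensorRank_kroneckerPow_le_of_asymptoticRank_lt T hlt
  -- an exponent `e = M i` on the progression with `e ε > 4`
  set i : ℕ := ⌈4 / ε⌉₊ + 1 with hi
  set e : ℕ := M * i with he
  have hi_gt : 4 / ε < (i : ℝ) := by
    rw [hi]; push_cast; linarith [Nat.le_ceil (4 / ε)]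
  have hM1' : (1 : ℝ) ≤ (M : ℝ) := by exact_mod_cast hM1
  have hi0 : (0 : ℝ) ≤ (i : ℝ) := Nat.cast_nonneg i
  have hie : (i : ℝ) ≤ (e : ℝ) := by
    rw [he]; push_cast; nlinarith
  have heε : 4 < (e : ℝ) * ε := by
    have h := (div_lt_iff₀ hε).1 (hi_gt.trans_le hie)
    linarith
  have he1 : 1 ≤ e := Nat.mul_pos hM1 (Nat.succ_pos _)
  have hRe : (tensorRank (kroneckerPow T e) : ℝ) ≤ ((2 : ℝ) ^ a) ^ e := hM e i rfl
  -- `x = e a`, `N = ⌈x⌉`, `m = 2^e`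
  set x : ℝ := (e : ℝ) * a with hx
  have hx0 : 0 ≤ x := by rw [hx]; positivity
  refine ⟨⌈x⌉₊, 2 ^ e, le_trans (by norm_num) (Nat.pow_le_pow_right (by norm_num) he1), ?_, ?_⟩
  · -- the degeneration, through the rank of the `e`-th power
    have hrank : (tensorRank (matMulTensor ℂ (2 ^ e) ((2 ^ e) ^ k) (2 ^ e)) : ℝ) ≤
        (2 : ℝ) ^ (⌈x⌉₊ + 1) :=
      calc (tensorRank (matMulTensor ℂ (2 ^ e) ((2 ^ e) ^ k) (2 ^ e)) : ℝ)
          ≤ tensorRank (kroneckerPow T e) := by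
            exact_mod_cast (kroneckerPow_farTensor_restrictsTo k e).tensorRank_le
        _ ≤ ((2 : ℝ) ^ a) ^ e := hRe
        _ = (2 : ℝ) ^ x := by
            rw [hx, ← Real.rpow_natCast, ← Real.rpow_mul (by norm_num), mul_comm]
        _ ≤ (2 : ℝ) ^ (⌈x⌉₊ : ℝ) := Real.rpow_le_rpow_of_exponent_le one_le_two (Nat.le_ceil x)
        _ = (2 : ℝ) ^ ⌈x⌉₊ := Real.rpow_natCast 2 ⌈x⌉₊
        _ ≤ (2 : ℝ) ^ (⌈x⌉₊ + 1) := pow_le_pow_right₀ one_le_two (Nat.le_succ _)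
    have hnat : tensorRank (matMulTensor ℂ (2 ^ e) ((2 ^ e) ^ k) (2 ^ e)) ≤ 2 ^ (⌈x⌉₊ + 1) := by
      exact_mod_cast hrank
    exact ((kroneckerPow_unitTensor_restrictsTo_iff 2 (⌈x⌉₊ + 1) _).2 hnat).algDegeneratesTo
  · -- the budget `2^{N+1} ≤ m^{(k+1)(1+ε)}`
    have hN : ((⌈x⌉₊ : ℕ) : ℝ) < x + 1 := Nat.ceil_lt_add_one hx0
    have hm : ((2 ^ e : ℕ) : ℝ) ^ (((k : ℝ) + 1) * (1 + ε)) =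
        (2 : ℝ) ^ ((e : ℝ) * (((k : ℝ) + 1) * (1 + ε))) := by
      push_cast
      rw [← Real.rpow_natCast 2 e, ← Real.rpow_mul (by norm_num)]
    have hsplit : (e : ℝ) * (((k : ℝ) + 1) * (1 + ε)) = x + (e : ℝ) * ((k : ℝ) + 1) * ε / 2 := by
      rw [hx, ha]; ring
    have h4 : 4 ≤ (e : ℝ) * ((k : ℝ) + 1) * ε := by
      have h1 : (e : ℝ) * ε ≤ (e : ℝ) * ((k : ℝ) + 1) * ε := by
        have : (0 : ℝ) ≤ (e : ℝ) * ε * k := by positivity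
        nlinarith
      linarith
    have hpow : (2 : ℝ) ^ (⌈x⌉₊ + 1) = (2 : ℝ) ^ (((⌈x⌉₊ : ℕ) : ℝ) + 1) := by
      rw [← Real.rpow_natCast]; push_cast; rfl
    rw [hm, hpow]
    exact Real.rpow_le_rpow_of_exponent_le one_le_two (by linarith)

/-! ## §2 The special branch, as an existence statement, IS the crux -/

/-- ★ **Every host renormalises to the unit host, at the same shape**: if ANY tensor `t` with ANY
admissible proxy `r ≥ R̃(t)` (border-flat or strictly flat) hosts `(1,k,1)` in the sense of Kernel
XLIX, then so does `⟨2⟩` with budget `2^{N+1}` — through the exponent (`omegaRect_eq_of_host`, then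
unit domination), with no composition of degenerations.  At the level of existence the host
dichotomy S ∨ G collapses onto its universal special member.
[cite: ChristandlLeGallLysikovZuiddam2025, Thm. 2.1] [cite: BurgisserClausenShokrollahi1997, (14.19)] -/
theorem unitHost_of_host {ι κ μ : Type} [Fintype ι] [Fintype κ] [Fintype μ] [DecidableEq ι]
    [DecidableEq κ] [DecidableEq μ] {t : ι → κ → μ → ℂ} {r : ℝ} {k : ℕ}
    (hr : asymptoticRank t ≤ r)
    (hhost : ∀ ε : ℝ, 0 < ε → ∃ N m : ℕ, 2 ≤ m ∧
      AlgDegeneratesTo (kroneckerPow t (N + 1)) (matMulTensor ℂ m (m ^ k) m) ∧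
      r ^ (N + 1) ≤ (m : ℝ) ^ (((k : ℝ) + 1) * (1 + ε))) :
    ∀ ε : ℝ, 0 < ε → ∃ N m : ℕ, 2 ≤ m ∧
      AlgDegeneratesTo (kroneckerPow (unitTensor ℂ 2) (N + 1)) (matMulTensor ℂ m (m ^ k) m) ∧
      (2 : ℝ) ^ (N + 1) ≤ (m : ℝ) ^ (((k : ℝ) + 1) * (1 + ε)) :=
  unitHost_of_saturated (omegaRect_eq_of_host hr hhost)

/-- ★★ **`FiniteSaturation ⟺ ∃ k ≥ 2, ⟨2⟩ is a border-flat host of `(1,k,1)`** (budget `2^{N+1}`,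
`R̲(⟨2⟩) = 2`; `⟸` is Kernel XLIX-B's `finiteSaturation_of_borderHost`, `⟹` is unit domination).
Tag EQUIV/COSTUME as a piece. [cite: BurgisserClausenShokrollahi1997, Lemma (15.27)]
[cite: LottiRomani1983, Prop. 4.1] -/
theorem finiteSaturation_iff_unitHost :
    FiniteSaturation ↔ ∃ k : ℕ, 2 ≤ k ∧ ∀ ε : ℝ, 0 < ε → ∃ N m : ℕ, 2 ≤ m ∧
      AlgDegeneratesTo (kroneckerPow (unitTensor ℂ 2) (N + 1)) (matMulTensor ℂ m (m ^ k) m) ∧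
      (2 : ℝ) ^ (N + 1) ≤ (m : ℝ) ^ (((k : ℝ) + 1) * (1 + ε)) := by
  constructor
  · rintro ⟨k, hk, hsat⟩
    exact ⟨k, hk, unitHost_of_saturated hsat⟩
  · rintro ⟨k, hk, hhost⟩
    refine finiteSaturation_of_borderHost (t := unitTensor ℂ 2) hk algBorderRank_unitTensor_two_le
      fun ε hε => ?_
    obtain ⟨N, m, hm, hd, hb⟩ := hhost ε hε
    exact ⟨N, m, hm, hd, by exact_mod_cast hb⟩

/-- ★★★ **THE SPECIAL BRANCH IS EQUIV**: `FiniteSaturation ⟺ ∃ k ≥ 2 ∃ a border-flat host of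
`(1,k,1)` of ANY finite format and ANY budget `b ≥ R̲(t)`**.  The host dichotomy of Kernel XLIX
therefore sorts CERTIFICATES of `h₁` (one border identity vs. a below-border theorem), not pieces of
it: both «∃ S-host» (here) and «∃ G-host» (`finiteSaturation_iff_selfHost`) restate the crux.
[cite: BurgisserClausenShokrollahi1997, (15.19), Lemma (15.27)] [cite: AlmanLi2026, Cor. 6.1] -/
theorem finiteSaturation_iff_exists_borderHost :
    FiniteSaturation ↔ ∃ k : ℕ, 2 ≤ k ∧ ∃ (a b c : ℕ) (t : Fin a → Fin b → Fin c → ℂ) (B : ℕ),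
      algBorderRank t ≤ B ∧ ∀ ε : ℝ, 0 < ε → ∃ N m : ℕ, 2 ≤ m ∧
        AlgDegeneratesTo (kroneckerPow t (N + 1)) (matMulTensor ℂ m (m ^ k) m) ∧
        (B : ℝ) ^ (N + 1) ≤ (m : ℝ) ^ (((k : ℝ) + 1) * (1 + ε)) := by
  constructor
  · rintro ⟨k, hk, hsat⟩
    refine ⟨k, hk, 2, 2, 2, unitTensor ℂ 2, 2, algBorderRank_unitTensor_two_le, fun ε hε => ?_⟩
    obtain ⟨N, m, hm, hd, hb⟩ := unitHost_of_saturated hsat ε hε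
    exact ⟨N, m, hm, hd, by exact_mod_cast hb⟩
  · rintro ⟨k, hk, a, b, c, t, B, hB, hhost⟩
    exact finiteSaturation_of_borderHost hk hB hhost

/-- **The universal special host passes the format screen of Kernel XLIX-A with equality**:
`R̲(⟨2⟩) ≤ 2 = |κ| = |μ|` — the screen «`r ≤ min(|κ|,|μ|)`, never slack» (`le_card_of_host`,
`borderHost_flat`) cannot separate candidates inside the special pool. [folklore] -/
theorem unitTensor_two_screen :
    algBorderRank (unitTensor ℂ 2) ≤ Fintype.card (Fin 2) ∧ Fintype.card (Fin 2) = 2 :=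
  ⟨by simpa using algBorderRank_unitTensor_two_le, Fintype.card_fin 2⟩

/-! ## §4 The crux in finite terms: one good format per tolerance

With the host gone, what is left of the special branch is a statement about the border rank of the
far pencil itself, and it needs only ONE format per tolerance: a single `m ≥ 2` with
`R̲(⟨m,m^k,m⟩) ≤ m^{(k+1)(1+ε)}` already bounds the exponent (`m^{ω(1,k,1)} = R̃ ≤ R̲`, the tree's
`asymptoticRank_le_algBorderRank`, BCS (15.27)); conversely saturation supplies such formats along
`m = 2^e` (§1–§2 and `t ⊴ ⟨r⟩ ⟹ R̲(t) ≤ r`, BCS (15.19)–(15.20)). -/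

/-- ★★★★ **`FiniteSaturation` in finite terms**:
`FiniteSaturation ⟺ ∃ k ≥ 2, ∀ ε > 0, ∃ m ≥ 2, R̲(⟨m, m^k, m⟩) ≤ m^{(k+1)(1+ε)}` — for some far shape,
every tolerance above flattening is met by the BORDER RANK of at least one single format.  No host,
no power, no limit in the statement: the special branch of Kernel XLIX is the design of approximate
bilinear algorithms for one skinny format at a time.
[cite: BurgisserClausenShokrollahi1997, (15.19)–(15.20), Lemma (15.27)]
[cite: AlmanDuanVassilevskaWilliamsXuXuZhou2025, §3.4] -/
theorem finiteSaturation_iff_exists_algBorderRank_le :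
    FiniteSaturation ↔ ∃ k : ℕ, 2 ≤ k ∧ ∀ ε : ℝ, 0 < ε → ∃ m : ℕ, 2 ≤ m ∧
      (algBorderRank (matMulTensor ℂ m (m ^ k) m) : ℝ) ≤ (m : ℝ) ^ (((k : ℝ) + 1) * (1 + ε)) := by
  constructor
  · intro h
    obtain ⟨k, hk, hhost⟩ := finiteSaturation_iff_unitHost.mp h
    refine ⟨k, hk, fun ε hε => ?_⟩
    obtain ⟨N, m, hm, hdeg, hcost⟩ := hhost ε hε
    refine ⟨m, hm, le_trans ?_ hcost⟩
    have hdeg' : AlgDegeneratesTo (unitTensor ℂ (2 ^ (N + 1))) (matMulTensor ℂ m (m ^ k) m) :=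
      (unitTensor_pow_restrictsTo 2 (N + 1)).algDegeneratesTo_trans hdeg
    have hb : algBorderRank (matMulTensor ℂ m (m ^ k) m) ≤ 2 ^ (N + 1) :=
      MatrixPencil.algBorderRank_le_of_algDegeneratesTo_unitTensor hdeg'
    exact_mod_cast hb
  · rintro ⟨k, hk, h⟩
    refine ⟨k, hk, le_antisymm ?_ (add_one_le_omegaRect_farEdge k)⟩
    refine le_of_forall_pos_lt_add fun δ hδ => ?_
    have hk1 : (0 : ℝ) < (k : ℝ) + 1 := by positivity
    obtain ⟨m, hm, hB⟩ := h (δ / (2 * ((k : ℝ) + 1))) (by positivity)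
    have hm1 : (1 : ℝ) < m := by exact_mod_cast hm
    have hR : (m : ℝ) ^ omegaRect ℂ 1 k 1 ≤
        (m : ℝ) ^ (((k : ℝ) + 1) * (1 + δ / (2 * ((k : ℝ) + 1)))) := by
      rw [rpow_omegaRect_eq_asymptoticRank_farEdge hm k]
      exact (asymptoticRank_le_algBorderRank _).trans hB
    have hexp : omegaRect ℂ 1 k 1 ≤ ((k : ℝ) + 1) * (1 + δ / (2 * ((k : ℝ) + 1))) :=
      (Real.rpow_le_rpow_left_iff hm1).mp hR
    have hid : ((k : ℝ) + 1) * (1 + δ / (2 * ((k : ℝ) + 1))) = (k : ℝ) + 1 + δ / 2 := by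
      field_simp
    linarith

end Summit.MatrixMultiplication.MatrixMultiplication.Theorems.FarEdgeDescentHostUnit
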